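import Mathlib
import Literature.AlgebraicGeometry.Surfaces.PolarisedK3TwinKuranishiFamily
import Literature.AlgebraicGeometry.Surfaces.K3PeriodSurjectivityProofs
import Literature.AlgebraicGeometry.Surfaces.K3TwistorLines
import HarnessLib

/-!
# OrthogonalGroupOrbitClosures

Topic `Literature/Dynamics/Homogeneous`. Named literature fact(s) relocated by the gate from `Summits/HodgeConjecture/HodgeConjecture/Theorems/NikulinTwinTransportK3PeriodSurjectiveStubOrbitClosureMeetsCM.lean`
(accept-time relocation of `[cite]`d propositions written inline in a Summits proposal; human ruling 2026-08-15).
Sources: Verbitsky2015Ergodic, Verbitsky2017ErgodicErratum.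

* `Literature.Dynamics.Homogeneous.Verbitsky2017_orbitClosure_trichotomy_K3`
-/

namespace Literature.Dynamics.Homogeneous

open scoped Matrix Topology
open Literature.AlgebraicGeometry Literature.AlgebraicGeometry.Surfaces

/-- **Verbitsky's orbit-closure trichotomy for positive `2`-planes, K3 lattice** (named fact).
Verbitsky, *Ergodic complex structures on hyperkähler manifolds: an erratum* (arXiv:1708.05802),
§2.3, verbatim: "Consider an integral lattice `V_ℤ = ℤ^{a+b}` equipped with an integer-valued
scalar product `q` of signature `(a,b)`, `a > 2`, `b > 0`, `a + b > 4`, `V := V_ℤ ⊗_ℤ ℝ`,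
`Γ ⊂ SO(V_ℤ)` a finite index sublattice, `l ∈ Gr₊₊(V)` a point, and `Γ l ⊂ Gr₊₊(V)` its orbit.
Then one of the following three possibilities is true. (i) `Γ l` is closed. This happens when the
2-plane `l ⊂ V` is rational. (ii) `Γ l` is dense in `Gr₊₊(V)`. This happens when `l` contains no
rational vectors. (iii) The closure `cl(Γ l)` is the set of all 2-planes `V₁ ∈ Gr₊₊(V)` containing
a 1-dimensional rational subspace `v ⊂ V_ℚ`." — the intermediate class being
`dim_ℚ (l ∩ V_ℚ) = 1` (ibid. §1.1); proved there from Ratner's orbit-closure theorem for the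
unipotent-generated `SO⁺(a−2,b) ⊂ SO⁺(a,b)` (§2.2, Thm.) and the classification of intermediate
subgroups `SO⁺(a−2,b) ⊂ SO⁺(a−1,b) ⊂ SO⁺(a,b)` (§2.1, Thm.); it corrects Thm. 4.8 of the Acta paper
("the `Γ`-orbit of `I` is dense in `Per` unless the plane `V` is rational"), where (iii) was
overlooked. Here `Gr₊₊(V) = SO⁺(a,b)/SO⁺(a−2,b) × SO(2)` is the Grassmannian of oriented positive
2-planes, identified (§2.3, Claim) with `Per = {l ∈ ℙ(V_ℂ) | q(l,l) = 0, q(l, l̄) > 0}`.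

RENDERING, for `V_ℤ = Λ_{K3} = E₈(−1)^{⊕2} ⊕ U^{⊕3}` (`k3Gram`; signature `(3,19)`: `a = 3 > 2`,
`b = 19 > 0`, `a + b = 22 > 4`) and `Γ = SO(Λ_{K3})` itself (integral `g` with `gᵀ Λ g = Λ`,
`det g = 1`, acting by `x ↦ g x`). Points of `Per` are represented by vectors of Huybrechts' period
domain `D = k3PeriodDomain ⊂ Λ_ℂ = ℂ²²` (`(x.x) = 0`, `(x̄.x) > 0`; the plane of `x` is
`l_x = ⟨Re x, Im x⟩_ℝ`, `k3Period_iff_re_im`), so the orbit `Γ[x]` is represented by the cone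
`Γℂˣx = {t • g x | g ∈ Γ, t ≠ 0}` and — `ℂ²² ∖ 0 → ℙ(Λ_ℂ)` being an open quotient map — for
`y ∈ D`: `[y] ∈ cl(Γ[x])` in `Gr₊₊ ≅ Per` iff `y ∈ closure (Γℂˣx)` in `ℂ²²`; "closed" reads
`D ∩ closure (Γℂˣx) ⊆ Γℂˣx`, "dense" reads `D ⊆ closure (Γℂˣx)`. A lattice vector `v` lies in
`l_x` iff `v = a Re x + b Im x` with `a, b ∈ ℝ`; `l_x` is rational (`dim_ℚ (l_x ∩ Λ_ℚ) = 2`) iff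
`Re x` and `Im x` are real combinations of two lattice vectors; (ii)'s hypothesis is "every lattice
vector in `l_x` is `0`"; (iii) is the remaining case (a non-zero lattice `v ∈ l_x`, `l_x` not
rational) and is rendered by the two inclusions its wording yields under any quantification of the
rational line — every `y ∈ D` whose plane contains `v` lies in the closure, and the plane of every
`y ∈ D` in the closure contains a non-zero lattice vector (the closure being `Γ · Gr₊₊(v)` by the
proof, `Stab v = SO⁺(a−1,b)` the intermediate subgroup) — WEAKER than print there. One lattice, one
`Γ`; no Teichmüller space, no hyperkähler geometry.
[cite: Verbitsky2017ErgodicErratum, §2.3 Thm. 2.5 (i)–(iii); §2.2 (Ratner for SO⁺(a−2,b) ⊂ SO⁺(a,b)), §2.1]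
[cite: Verbitsky2015Ergodic, Thm. 4.8 (as corrected by the 2017 erratum)]
[topic Dynamics/Homogeneous] [file Dynamics/Homogeneous/OrthogonalGroupOrbitClosures] -/
def Verbitsky2017_orbitClosure_trichotomy_K3 : Prop :=
  ∀ x : K3Index → ℂ, x ∈ k3PeriodDomain →
    -- the `SO(Λ) × ℂˣ`-orbit of `x`, representing `Γ[x] ⊂ Per ≅ Gr₊₊(Λ_ℝ)`
    let orbit : Set (K3Index → ℂ) :=
      {z | ∃ (g : Matrix K3Index K3Index ℤ) (t : ℂ), g.transpose * k3Gram * g = k3Gram ∧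
        g.det = 1 ∧ t ≠ 0 ∧ z = t • (g.map (Int.cast : ℤ → ℂ) *ᵥ x)}
    -- "the lattice vector `v` lies in the real plane `⟨Re y, Im y⟩`"
    let InPlane : (K3Index → ℤ) → (K3Index → ℂ) → Prop := fun v y =>
      ∃ a b : ℝ, ∀ i, (v i : ℝ) = a * (y i).re + b * (y i).im
    -- "the plane `⟨Re x, Im x⟩` is rational": spanned over `ℝ` by two lattice vectors
    let IsRationalPlane : Prop :=
      ∃ (u w : K3Index → ℤ) (a b c d : ℝ), ∀ i,
        (x i).re = a * u i + b * w i ∧ (x i).im = c * u i + d * w i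
    -- TODO(general form): any integral lattice `V_ℤ` of signature `(a,b)`, `a > 2`, `b > 0`,
    -- `a + b > 4`, any finite-index `Γ ⊂ SO(V_ℤ)`, and (iii) as the equality
    -- `closure (Γ l) = Γ · Gr₊₊(v)`, `ℚ v = l ∩ V_ℚ` (needs a Grassmannian `Gr₊₊(V_ℝ)` carrier).
    -- (i) rational plane ⇒ closed orbit
    (IsRationalPlane → ∀ y : K3Index → ℂ, y ∈ k3PeriodDomain → y ∈ closure orbit → y ∈ orbit) ∧
    -- (ii) no rational vector in the plane ⇒ dense orbit
    ((∀ v : K3Index → ℤ, InPlane v x → v = 0) →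
      ∀ y : K3Index → ℂ, y ∈ k3PeriodDomain → y ∈ closure orbit) ∧
    -- (iii) the intermediate orbits: `Gr₊₊(v) ⊆ closure ⊆ {planes containing a rational line}`
    (∀ v : K3Index → ℤ, v ≠ 0 → InPlane v x → ¬ IsRationalPlane →
      (∀ y : K3Index → ℂ, y ∈ k3PeriodDomain → InPlane v y → y ∈ closure orbit) ∧
      (∀ y : K3Index → ℂ, y ∈ k3PeriodDomain → y ∈ closure orbit →
        ∃ w : K3Index → ℤ, w ≠ 0 ∧ InPlane w y))

/-! ### Lattice linear algebra on `Λ_{K3}` (unconditional) -/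

end Literature.Dynamics.Homogeneous
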